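import Summits.ABC.StewartYu.ArchG3PackClosedVD
import Literature.NumberTheory.Transcendental.Waldschmidt1980Numeric
import HarnessLib

/-!
# Cell abc-stewartyu, rung A1.L (crux r2 `ArchCoreRat`), WP-L.A: the k-step / half-step record packages at `S(θ)` from LOG-LINEAR LINES
# (the «lines» layer of `stub_packsArch`, R38 (3)): every product inequality `hineq` from three letter inequalities of the record

`Summits/ABC/StewartYu/ArchG3PackLinesV.lean` — sequel to `ArchG3PackClosedVD` (cell `abc-stewartyu`, HOME `run/shared/lean/pub/abc-stewartyu/`;
plan RULINGS R34 / R38 (3); seat p5 g8).  Theorems on `ArchG3Setup`; no definition, no named fact, no record.  Archimedean twin of the M3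
«lines» files (`PadicG3OddLines`, `PadicG3OneLines`, …): the ONE numerical inequality of each D-pack (`ArchKStepHypD` / `ArchKStepOddHypD`
/ `ArchHalfStepHypD`, V-instances of `ArchG3PackClosedVD`) has the shape `e^{γb·N′}·(J + F) + Cmp < R`; it follows from the three LOG lines
`γb N′ + log J ≤ −log(3/R)`, `γb N′ + log F ≤ −log(3/R)`, `log Cmp < −log(3/R)` once every atom is written as (or majorised by) an
exponential: exact logarithms for the closed forms (`DΔC`, `WC`, `(2C)^t`, the Hermite constant `2(2N+1)^{t+1}t(20e)^{(2N+1)t}`, `2ᵃ`,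
`(1/E)^{(2N+1)t}`), record CEILINGS for the data atoms (`#U ≤ e^{cU}`, `P ≤ e^{cP}`, `2L_{j₀}δ₀N ≤ e^{cb}` — the box atom may vanish at
deep levels, so it is majorised, not logged), and the VIRTUAL denominator bound `log(ν(H)^a·Dmv Bv x₁) ≤ (23/20)aH + 2|x₁|Σ(Bvⱼ/N)Vⱼ + 2ΣVⱼ`
(`ArchSupply.log_lcm_pow_le`, `SatData.log_Dmv_le_of_weights`).

* `le_third_of_log_line`, `lt_third_of_log_line` — the bookkeeping (`W80Par.mul_le_exp_add` from the Waldschmidt-1980 numerics);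
* **`kstep_ineqV_of_logLines`** — the symmetric k-step's `hineq` at `(x₁, a)` from the lines (J)/(F)/(C);
* **`archKStepHypD_of_logLinesV`** — `ArchKStepHypD … (V := virtual box) …` from the schedule data, the ceilings and the three lines
  `∀ x₁ a, |x₁| ≤ N′ → a < T′ → …`.
* `kstep_odd_ineq_of_logLines` / **`archKStepOddHypD_of_logLinesV`** — the odd-node (first) k-step of a level, likewise.
(The half-step analogue is the sequel `ArchG3PackLinesVH`.)

WHAT THIS IS NOT: the lines themselves (record `ArchG3RecA/B`, seat p1); no crux moves.

## References
* Yu. V. Nesterenko, LNM 1819 (2003) — §4.2 (4.24)–(4.35) p. 87–90 (the k-step budget), §3.4 (3.41)–(3.44) (denominators over `𝔑`).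
  [Nesterenko2003]
* K. Yu, Acta Math. 211 (2013) — Lemma 5.2 (the `p`-adic model; cell files `PadicG3OddLines`). [Yu2013]
-/

noncomputable section

open Finset Polynomial
open scoped Matrix
open Literature.NumberTheory.Transcendental
open Literature.NumberTheory.Transcendental.CW77.Setup (Tau tauNorm)
open Summit.ABC.StewartYu.ArchSupply (scaledFeldR WC)
open Literature.NumberTheory.Transcendental.Waldschmidt1980.W80Par (mul_le_exp_add)
open scoped Nat

namespace Summit.ABC.StewartYu

namespace ArchG3Setup

variable (S : ArchG3Setup) {K : Type*}

/-! ### Bookkeeping: products under exponential ceilings -/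

/-- `0 < x` ⇒ `x ≤ e^{log x}` (in fact `=`). [folklore] -/
theorem le_exp_log_of_pos {x : ℝ} (hx : 0 < x) : x ≤ Real.exp (Real.log x) := (Real.exp_log hx).ge

/-- A part bounded in logarithm by `−log D − log 3` is at most a third of `1/D`. [folklore] -/
theorem le_third_of_log_line {X ℓ : ℝ} {D : ℕ} (hD : 1 ≤ D) (hX : X ≤ Real.exp ℓ) (hℓ : ℓ + Real.log D + Real.log 3 ≤ 0) :
    X ≤ 1 / (D : ℝ) / 3 := by
  have hD0 : (0 : ℝ) < D := by exact_mod_cast hD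
  refine hX.trans ?_
  have : Real.exp ℓ ≤ Real.exp (-Real.log D - Real.log 3) := Real.exp_le_exp.mpr (by linarith)
  refine this.trans (le_of_eq ?_)
  rw [show -Real.log D - Real.log 3 = -(Real.log D + Real.log 3) by ring, Real.exp_neg, ← Real.log_mul hD0.ne' (by norm_num),
    Real.exp_log (by positivity)]
  field_simp

/-- Strict version. [folklore] -/
theorem lt_third_of_log_line {X ℓ : ℝ} {D : ℕ} (hD : 1 ≤ D) (hX : X ≤ Real.exp ℓ) (hℓ : ℓ + Real.log D + Real.log 3 < 0) :
    X < 1 / (D : ℝ) / 3 := by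
  have hD0 : (0 : ℝ) < D := by exact_mod_cast hD
  refine lt_of_le_of_lt hX ?_
  have : Real.exp ℓ < Real.exp (-Real.log D - Real.log 3) := Real.exp_lt_exp.mpr (by linarith)
  refine lt_of_lt_of_le this (le_of_eq ?_)
  rw [show -Real.log D - Real.log 3 = -(Real.log D + Real.log 3) by ring, Real.exp_neg, ← Real.log_mul hD0.ne' (by norm_num),
    Real.exp_log (by positivity)]
  field_simp

/-! ### The symmetric k-step inequality from three log lines -/

/-- **The symmetric k-step's `hineq` at `(x₁, a)` from the lines (J)/(F)/(C).**  Atoms: the Hermite constant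
`Hm = 2(2N+1)^{t+1}t(20e)^{(2N+1)t}`, `(2C)^t`, `2ᵃ`, `DΔ > 0`, `Wn, Wd > 0` enter with their exact logarithms; `#U ≤ e^{cU}`, `P ≤ e^{cP}`,
`2L_{j₀}δ₀N ≤ e^{cb}`, `2L_{j₀}δ₀N′ ≤ e^{cb′}` are ceilings; the denominator `Dn ≥ 1` enters through a ceiling `log Dn ≤ cD`.
[cite: Nesterenko2003, §4.2 (4.24)–(4.35), p. 87–90; shape only] -/
theorem kstep_ineq_of_logLines {N N' t a : ℕ} (ht : 1 ≤ t) {γb w C E DΔ Wn Wd P δ₀ Lj SΓ : ℝ} {Uc : ℕ}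
    (hC : 1 ≤ C) (hE : 1 ≤ E) (hDΔ : 0 < DΔ) (hWn : 0 < Wn) (hWd : 0 < Wd) (hP0 : 0 ≤ P) (hδ : 0 ≤ δ₀) (hLj : 0 ≤ Lj)
    {cU cP cb cb' cD : ℝ} (hU : (Uc : ℝ) ≤ Real.exp cU) (hP : P ≤ Real.exp cP)
    (hb : 2 * (Lj * δ₀ * N) ≤ Real.exp cb) (hb' : 2 * (Lj * δ₀ * N') ≤ Real.exp cb')
    {Dn : ℕ} (hDn : 1 ≤ Dn) (hD : Real.log Dn ≤ cD)
    (hJ : γb * N' + Real.log (2 * ((2 * N + 1 : ℕ) : ℝ) ^ (t + 1) * t * (20 * Real.exp 1) ^ ((2 * N + 1) * t)) +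
        t * Real.log (2 * C) + γb * (N + 1) + a * Real.log 2 + SΓ / C + cU + cP + Real.log DΔ + Real.log Wn + (γb + w) * N + cb +
        cD + Real.log 3 ≤ 0)
    (hF : γb * N' + cU + cP + Real.log DΔ + Real.log Wd + (w + Lj * δ₀) * ((3 * E + 1) * (2 * N + 1) + N) -
        ((2 * N + 1) * t : ℕ) * Real.log E + cD + Real.log 3 ≤ 0)
    (hCmp : cU + cP + Real.log DΔ + Real.log Wn + (γb + w) * N' + cb' + cD + Real.log 3 < 0) :
    Real.exp (γb * N') *
        (2 * ((2 * N + 1 : ℕ) : ℝ) ^ (t + 1) * t * (20 * Real.exp 1) ^ ((2 * N + 1) * t) *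
            ((2 * C) ^ t * Real.exp (γb * (N + 1)) *
              ((2 : ℝ) ^ a * Real.exp (SΓ / C) *
                (Uc * (P * DΔ) * Wn * Real.exp ((γb + w) * N) * (2 * (Lj * δ₀ * N))))) +
          Uc * (P * DΔ) * Wd * Real.exp ((w + Lj * δ₀) * ((3 * E + 1) * (2 * N + 1) + N)) * (1 / E) ^ ((2 * N + 1) * t)) +
        Uc * (P * DΔ) * Wn * Real.exp ((γb + w) * N') * (2 * (Lj * δ₀ * N')) <
      1 / (Dn : ℝ) := by
  -- positivity of the exact atoms
  have ht0 : (0 : ℝ) < t := by exact_mod_cast ht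
  have hHm : 0 < 2 * ((2 * N + 1 : ℕ) : ℝ) ^ (t + 1) * t * (20 * Real.exp 1) ^ ((2 * N + 1) * t) := by positivity
  have hC0 : 0 < C := by linarith
  have hE0 : 0 < E := by linarith
  have hUc0 : (0 : ℝ) ≤ Uc := Nat.cast_nonneg _
  -- exact atoms as exponentials
  have eCt : (2 * C) ^ t = Real.exp (t * Real.log (2 * C)) := by
    rw [← Real.log_pow, Real.exp_log (by positivity)]
  have e2a : (2 : ℝ) ^ a = Real.exp (a * Real.log 2) := by
    rw [← Real.log_pow, Real.exp_log (by positivity)]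
  have eE : (1 / E) ^ ((2 * N + 1) * t) = Real.exp (-(((2 * N + 1) * t : ℕ) * Real.log E)) := by
    rw [one_div, inv_pow, Real.exp_neg, ← Real.log_pow, Real.exp_log (pow_pos hE0 _)]
  -- the common core `#U·(P·DΔ)·W·e^{…}`
  have hPD : P * DΔ ≤ Real.exp (cP + Real.log DΔ) := mul_le_exp_add hP (le_exp_log_of_pos hDΔ) hDΔ.le
  have hPD0 : 0 ≤ P * DΔ := mul_nonneg hP0 hDΔ.le
  have coreN : (Uc : ℝ) * (P * DΔ) * Wn * Real.exp ((γb + w) * N) ≤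
      Real.exp (cU + (cP + Real.log DΔ) + Real.log Wn + (γb + w) * N) :=
    mul_le_exp_add (mul_le_exp_add (mul_le_exp_add hU hPD hPD0) (le_exp_log_of_pos hWn) hWn.le) le_rfl (Real.exp_pos _).le
  have coreN' : (Uc : ℝ) * (P * DΔ) * Wn * Real.exp ((γb + w) * N') ≤
      Real.exp (cU + (cP + Real.log DΔ) + Real.log Wn + (γb + w) * N') :=
    mul_le_exp_add (mul_le_exp_add (mul_le_exp_add hU hPD hPD0) (le_exp_log_of_pos hWn) hWn.le) le_rfl (Real.exp_pos _).le
  have coreD : (Uc : ℝ) * (P * DΔ) * Wd * Real.exp ((w + Lj * δ₀) * ((3 * E + 1) * (2 * N + 1) + N)) ≤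
      Real.exp (cU + (cP + Real.log DΔ) + Real.log Wd + (w + Lj * δ₀) * ((3 * E + 1) * (2 * N + 1) + N)) :=
    mul_le_exp_add (mul_le_exp_add (mul_le_exp_add hU hPD hPD0) (le_exp_log_of_pos hWd) hWd.le) le_rfl (Real.exp_pos _).le
  have hcore0 : ∀ (W e b : ℝ), 0 ≤ W → 0 ≤ b → 0 ≤ (Uc : ℝ) * (P * DΔ) * W * Real.exp e * b := fun W e b hW hb0 => by positivity
  have hboxN0 : 0 ≤ 2 * (Lj * δ₀ * N) := by positivity
  have hboxN'0 : 0 ≤ 2 * (Lj * δ₀ * N') := by positivity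
  -- (J)
  have hJb : Real.exp (γb * N') *
      (2 * ((2 * N + 1 : ℕ) : ℝ) ^ (t + 1) * t * (20 * Real.exp 1) ^ ((2 * N + 1) * t) *
        ((2 * C) ^ t * Real.exp (γb * (N + 1)) *
          ((2 : ℝ) ^ a * Real.exp (SΓ / C) * (Uc * (P * DΔ) * Wn * Real.exp ((γb + w) * N) * (2 * (Lj * δ₀ * N)))))) ≤
      1 / (Dn : ℝ) / 3 := by
    have h1 : (Uc : ℝ) * (P * DΔ) * Wn * Real.exp ((γb + w) * N) * (2 * (Lj * δ₀ * N)) ≤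
        Real.exp (cU + (cP + Real.log DΔ) + Real.log Wn + (γb + w) * N + cb) := mul_le_exp_add coreN hb hboxN0
    have h2 : (2 : ℝ) ^ a * Real.exp (SΓ / C) * ((Uc : ℝ) * (P * DΔ) * Wn * Real.exp ((γb + w) * N) * (2 * (Lj * δ₀ * N))) ≤
        Real.exp (a * Real.log 2 + SΓ / C + (cU + (cP + Real.log DΔ) + Real.log Wn + (γb + w) * N + cb)) := by
      refine mul_le_exp_add (by rw [e2a, ← Real.exp_add]) h1 (hcore0 _ _ _ hWn.le hboxN0)
    have h3 : (2 * C) ^ t * Real.exp (γb * (N + 1)) *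
        ((2 : ℝ) ^ a * Real.exp (SΓ / C) * ((Uc : ℝ) * (P * DΔ) * Wn * Real.exp ((γb + w) * N) * (2 * (Lj * δ₀ * N)))) ≤
        Real.exp (t * Real.log (2 * C) + γb * (N + 1) + (a * Real.log 2 + SΓ / C +
          (cU + (cP + Real.log DΔ) + Real.log Wn + (γb + w) * N + cb))) :=
      mul_le_exp_add (by rw [eCt, ← Real.exp_add]) h2 (by positivity)
    have h4 := mul_le_exp_add (le_exp_log_of_pos hHm) h3 (by positivity)
    have h5 := mul_le_exp_add (le_refl (Real.exp (γb * N'))) h4 (by positivity)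
    refine le_third_of_log_line hDn h5 ?_
    linarith
  -- (F)
  have hFb : Real.exp (γb * N') *
      ((Uc : ℝ) * (P * DΔ) * Wd * Real.exp ((w + Lj * δ₀) * ((3 * E + 1) * (2 * N + 1) + N)) * (1 / E) ^ ((2 * N + 1) * t)) ≤
      1 / (Dn : ℝ) / 3 := by
    have h1 : (Uc : ℝ) * (P * DΔ) * Wd * Real.exp ((w + Lj * δ₀) * ((3 * E + 1) * (2 * N + 1) + N)) * (1 / E) ^ ((2 * N + 1) * t) ≤
        Real.exp (cU + (cP + Real.log DΔ) + Real.log Wd + (w + Lj * δ₀) * ((3 * E + 1) * (2 * N + 1) + N) +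
          -(((2 * N + 1) * t : ℕ) * Real.log E)) := mul_le_exp_add coreD (by rw [eE]) (by positivity)
    have h2 := mul_le_exp_add (le_refl (Real.exp (γb * N'))) h1 (by positivity)
    refine le_third_of_log_line hDn h2 ?_
    linarith
  -- (C)
  have hCb : (Uc : ℝ) * (P * DΔ) * Wn * Real.exp ((γb + w) * N') * (2 * (Lj * δ₀ * N')) < 1 / (Dn : ℝ) / 3 := by
    have h1 := mul_le_exp_add coreN' hb' hboxN'0
    refine lt_third_of_log_line hDn h1 ?_
    linarith
  -- assemble
  have hsplit : Real.exp (γb * N') *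
      (2 * ((2 * N + 1 : ℕ) : ℝ) ^ (t + 1) * t * (20 * Real.exp 1) ^ ((2 * N + 1) * t) *
          ((2 * C) ^ t * Real.exp (γb * (N + 1)) *
            ((2 : ℝ) ^ a * Real.exp (SΓ / C) * (Uc * (P * DΔ) * Wn * Real.exp ((γb + w) * N) * (2 * (Lj * δ₀ * N))))) +
        Uc * (P * DΔ) * Wd * Real.exp ((w + Lj * δ₀) * ((3 * E + 1) * (2 * N + 1) + N)) * (1 / E) ^ ((2 * N + 1) * t)) =
      Real.exp (γb * N') *
        (2 * ((2 * N + 1 : ℕ) : ℝ) ^ (t + 1) * t * (20 * Real.exp 1) ^ ((2 * N + 1) * t) *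
          ((2 * C) ^ t * Real.exp (γb * (N + 1)) *
            ((2 : ℝ) ^ a * Real.exp (SΓ / C) * (Uc * (P * DΔ) * Wn * Real.exp ((γb + w) * N) * (2 * (Lj * δ₀ * N)))))) +
      Real.exp (γb * N') *
        (Uc * (P * DΔ) * Wd * Real.exp ((w + Lj * δ₀) * ((3 * E + 1) * (2 * N + 1) + N)) * (1 / E) ^ ((2 * N + 1) * t)) := by
    ring
  rw [hsplit]
  linarith

/-! ### The symmetric k-step package at `S(θ)` from the lines -/

/-- **`ArchKStepHypD` at `S(θ)` from three log lines per `(x₁, a)`** (V := virtual box `Bv`, `Dm := Dmv Bv`): the schedule data and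
uniform ceilings as in `archKStepHypD_of_ineqV`, the data ceilings `#U ≤ e^{cU}`, `P ≤ e^{cP}`, `2L_{j₀}δ₀N ≤ e^{cb}`, `2L_{j₀}δ₀N′ ≤ e^{cb′}`,
weights `h(αoⱼ) ≤ Vⱼ`, and the lines (J)/(F)/(C) with the VIRTUAL denominator ceiling `cD(x₁, a) = (23/20)·a·H + 2|x₁|·Σⱼ(Bvⱼ/N)Vⱼ + 2ΣⱼVⱼ`.
[cite: Nesterenko2003, §4.2 (4.24)–(4.35) with §3.4 (3.43)–(3.44); shape only] -/
theorem archKStepHypD_of_logLinesV (F : S.SatData) {H : ℕ} (hH : 1 ≤ H) (ex L₀ : ℕ) (U : Finset (ℕ × K)) (hU : ∀ i ∈ U, i.1 ≤ L₀)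
    (L : Fin S.n → ℕ) {P : ℤ} (hP0 : 0 ≤ P) {w : ℝ} (hw : 0 ≤ w) (γb : ℝ) (c : ℤ) (e : Fin S.n → ℤ) {δ₀ : ℝ} (hδ : 0 ≤ δ₀)
    (Bv : Fin S.n → ℕ) {N N' T T' t : ℕ} (ht : 1 ≤ t) (hT : T' + t ≤ T) (hN' : N' ≤ 3 * N + 2) {A : Fin S.n → ℝ}
    (hA : ∀ k, |S.lg k| ≤ A k) {E : ℝ} (hE : 1 ≤ E) (hsmall : (L S.j₀ : ℝ) * δ₀ * (3 * N + 2) ≤ 1) {C : ℝ} (hC : 1 ≤ C)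
    {V : Fin S.n → ℝ} (hV : ∀ j, Height.logHeight₁ (F.αo j) ≤ V j)
    {cU cP cb cb' : ℝ} (hcU : (U.card : ℝ) ≤ Real.exp cU) (hcP : (P : ℝ) ≤ Real.exp cP)
    (hcb : 2 * ((L S.j₀ : ℝ) * δ₀ * N) ≤ Real.exp cb) (hcb' : 2 * ((L S.j₀ : ℝ) * δ₀ * N') ≤ Real.exp cb')
    (hJ : ∀ (x₁ : ℤ) (a : ℕ), |x₁| ≤ (N' : ℤ) → a < T' →
      γb * N' + Real.log (2 * ((2 * N + 1 : ℕ) : ℝ) ^ (t + 1) * t * (20 * Real.exp 1) ^ ((2 * N + 1) * t)) +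
        t * Real.log (2 * C) + γb * (N + 1) + a * Real.log 2 + (∑ k, A k * S.GammaC L k) / C + cU + cP +
        Real.log (DΔC (S.YC c e L) T') + Real.log (WC H ex L₀ T (3 * N + 2)) + (γb + w) * N + cb +
        (23 / 20 * a * H + 2 * |(x₁ : ℝ)| * (∑ j, ((Bv j : ℝ) / F.N) * V j) + 2 * ∑ j, V j) + Real.log 3 ≤ 0)
    (hFl : ∀ (x₁ : ℤ) (a : ℕ), |x₁| ≤ (N' : ℤ) → a < T' →
      γb * N' + cU + cP + Real.log (DΔC (S.YC c e L) T') + Real.log (WC H ex L₀ T' ((3 * E + 1) * (2 * N + 1) + N)) +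
        (w + (L S.j₀ : ℝ) * δ₀) * ((3 * E + 1) * (2 * N + 1) + N) - ((2 * N + 1) * t : ℕ) * Real.log E +
        (23 / 20 * a * H + 2 * |(x₁ : ℝ)| * (∑ j, ((Bv j : ℝ) / F.N) * V j) + 2 * ∑ j, V j) + Real.log 3 ≤ 0)
    (hCl : ∀ (x₁ : ℤ) (a : ℕ), |x₁| ≤ (N' : ℤ) → a < T' →
      cU + cP + Real.log (DΔC (S.YC c e L) T') + Real.log (WC H ex L₀ T (3 * N + 2)) + (γb + w) * N' + cb' +
        (23 / 20 * a * H + 2 * |(x₁ : ℝ)| * (∑ j, ((Bv j : ℝ) / F.N) * V j) + 2 * ∑ j, V j) + Real.log 3 < 0) :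
    S.ArchKStepHypD (fun i : ℕ × K => scaledFeldR i.1 H ex) U L P w γb c e δ₀ (fun w' => ∀ j, |(w' ᵥ* F.U) j| ≤ (Bv j : ℤ))
      N N' T T' := by
  have hH' : (0 : ℝ) < H := by exact_mod_cast hH
  have hDΔ : 0 < DΔC (S.YC c e L) T' := by unfold DΔC; have := S.YC_nonneg c e L; positivity
  have hWn : 0 < WC H ex L₀ T (3 * N + 2) := by unfold WC; positivity
  have hE0 : (0 : ℝ) ≤ E := le_trans zero_le_one hE
  have hWd : 0 < WC H ex L₀ T' ((3 * E + 1) * (2 * N + 1) + N) := by unfold WC; positivity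
  refine S.archKStepHypD_of_ineqV F hH ex L₀ U hU L P hw γb c e Bv ht hT hN' hA hE hsmall hC fun x₁ hx₁ a μ haμ => ?_
  have ha : a < T' := by omega
  have hDn : 1 ≤ (Nat.lcmUpto H) ^ a * F.Dmv Bv x₁ := one_le_mul (Nat.one_le_pow _ _ (Nat.lcmUpto_pos H)) (F.one_le_Dmv Bv x₁)
  have hD : Real.log ((((Nat.lcmUpto H) ^ a * F.Dmv Bv x₁ : ℕ)) : ℝ) ≤
      23 / 20 * a * H + 2 * |(x₁ : ℝ)| * (∑ j, ((Bv j : ℝ) / F.N) * V j) + 2 * ∑ j, V j := by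
    have h1 : (0 : ℝ) < (((Nat.lcmUpto H) ^ a : ℕ) : ℝ) := by exact_mod_cast pow_pos (Nat.lcmUpto_pos H) a
    have h2 : (0 : ℝ) < (F.Dmv Bv x₁ : ℝ) := by exact_mod_cast F.one_le_Dmv Bv x₁
    rw [Nat.cast_mul, Real.log_mul h1.ne' h2.ne']
    linarith [ArchSupply.log_lcm_pow_le H a, F.log_Dmv_le_of_weights Bv x₁ hV]
  exact kstep_ineq_of_logLines ht hC hE hDΔ hWn hWd (by exact_mod_cast hP0) hδ (Nat.cast_nonneg _) hcU hcP hcb hcb' hDn hD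
    (hJ x₁ a hx₁ ha) (hFl x₁ a hx₁ ha) (hCl x₁ a hx₁ ha)

/-! ### The odd-node k-step (first step of a level) from three log lines -/

/-- **The odd-node k-step's `hineq` at `(x₁, a)` from the lines (J)/(F)/(C)** (nodes `|x| ≤ 2m − 1 → |x| ≤ N′ ≤ 6m`; the Hermite constant is
`2(2m)^{t+1}t(20e)^{2mt}` with the extra `2^t`). [cite: Nesterenko2003, §4.2 with the nodes 𝒳_{s,0}, p. 87–90; shape only] -/
theorem kstep_odd_ineq_of_logLines {m N' t a : ℕ} (ht : 1 ≤ t) {γb w C E DΔ Wn Wd P δ₀ Lj SΓ : ℝ} {Uc : ℕ}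
    (hC : 1 ≤ C) (hE : 1 ≤ E) (hDΔ : 0 < DΔ) (hWn : 0 < Wn) (hWd : 0 < Wd) (hP0 : 0 ≤ P) (hδ : 0 ≤ δ₀) (hLj : 0 ≤ Lj)
    {cU cP cb cb' cD : ℝ} (hU : (Uc : ℝ) ≤ Real.exp cU) (hP : P ≤ Real.exp cP)
    (hb : 2 * (Lj * δ₀ * ((2 * m - 1 : ℕ) : ℝ)) ≤ Real.exp cb) (hb' : 2 * (Lj * δ₀ * N') ≤ Real.exp cb')
    {Dn : ℕ} (hDn : 1 ≤ Dn) (hD : Real.log Dn ≤ cD)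
    (hJ : γb * N' + Real.log (2 * ((2 * m : ℕ) : ℝ) ^ (t + 1) * t * (20 * Real.exp 1) ^ ((2 * m) * t)) + t * Real.log 2 +
        t * Real.log (2 * C) + γb * (2 * m) + a * Real.log 2 + SΓ / C + cU + cP + Real.log DΔ + Real.log Wn +
        (γb + w) * ((2 * m - 1 : ℕ) : ℝ) + cb + cD + Real.log 3 ≤ 0)
    (hF : γb * N' + cU + cP + Real.log DΔ + Real.log Wd + (w + Lj * δ₀) * ((12 * E + 6) * m) -
        ((2 * m) * t : ℕ) * Real.log E + cD + Real.log 3 ≤ 0)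
    (hCmp : cU + cP + Real.log DΔ + Real.log Wn + (γb + w) * N' + cb' + cD + Real.log 3 < 0) :
    Real.exp (γb * N') *
        (2 * ((2 * m : ℕ) : ℝ) ^ (t + 1) * t * (20 * Real.exp 1) ^ ((2 * m) * t) *
            (2 ^ t * ((2 * C) ^ t * Real.exp (γb * (2 * m)) *
              ((2 : ℝ) ^ a * Real.exp (SΓ / C) *
                (Uc * (P * DΔ) * Wn * Real.exp ((γb + w) * ((2 * m - 1 : ℕ) : ℝ)) *
                  (2 * (Lj * δ₀ * ((2 * m - 1 : ℕ) : ℝ))))))) +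
          Uc * (P * DΔ) * Wd * Real.exp ((w + Lj * δ₀) * ((12 * E + 6) * m)) * (1 / E) ^ ((2 * m) * t)) +
        Uc * (P * DΔ) * Wn * Real.exp ((γb + w) * N') * (2 * (Lj * δ₀ * N')) <
      1 / (Dn : ℝ) := by
  have ht0 : (0 : ℝ) < t := by exact_mod_cast ht
  have hC0 : 0 < C := by linarith
  have hE0 : 0 < E := by linarith
  -- exact atoms as exponentials (the Hermite constant vanishes for `m = 0`: cases below)
  have eCt : (2 * C) ^ t = Real.exp (t * Real.log (2 * C)) := by
    rw [← Real.log_pow, Real.exp_log (by positivity)]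
  have e2t : (2 : ℝ) ^ t = Real.exp (t * Real.log 2) := by
    rw [← Real.log_pow, Real.exp_log (by positivity)]
  have e2a : (2 : ℝ) ^ a = Real.exp (a * Real.log 2) := by
    rw [← Real.log_pow, Real.exp_log (by positivity)]
  have eE : (1 / E) ^ ((2 * m) * t) = Real.exp (-(((2 * m) * t : ℕ) * Real.log E)) := by
    rw [one_div, inv_pow, Real.exp_neg, ← Real.log_pow, Real.exp_log (pow_pos hE0 _)]
  have hPD : P * DΔ ≤ Real.exp (cP + Real.log DΔ) := mul_le_exp_add hP (le_exp_log_of_pos hDΔ) hDΔ.le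
  have hPD0 : 0 ≤ P * DΔ := mul_nonneg hP0 hDΔ.le
  have coreO : (Uc : ℝ) * (P * DΔ) * Wn * Real.exp ((γb + w) * ((2 * m - 1 : ℕ) : ℝ)) ≤
      Real.exp (cU + (cP + Real.log DΔ) + Real.log Wn + (γb + w) * ((2 * m - 1 : ℕ) : ℝ)) :=
    mul_le_exp_add (mul_le_exp_add (mul_le_exp_add hU hPD hPD0) (le_exp_log_of_pos hWn) hWn.le) le_rfl (Real.exp_pos _).le
  have coreN' : (Uc : ℝ) * (P * DΔ) * Wn * Real.exp ((γb + w) * N') ≤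
      Real.exp (cU + (cP + Real.log DΔ) + Real.log Wn + (γb + w) * N') :=
    mul_le_exp_add (mul_le_exp_add (mul_le_exp_add hU hPD hPD0) (le_exp_log_of_pos hWn) hWn.le) le_rfl (Real.exp_pos _).le
  have coreD : (Uc : ℝ) * (P * DΔ) * Wd * Real.exp ((w + Lj * δ₀) * ((12 * E + 6) * m)) ≤
      Real.exp (cU + (cP + Real.log DΔ) + Real.log Wd + (w + Lj * δ₀) * ((12 * E + 6) * m)) :=
    mul_le_exp_add (mul_le_exp_add (mul_le_exp_add hU hPD hPD0) (le_exp_log_of_pos hWd) hWd.le) le_rfl (Real.exp_pos _).le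
  have hboxO0 : 0 ≤ 2 * (Lj * δ₀ * ((2 * m - 1 : ℕ) : ℝ)) := by positivity
  have hboxN'0 : 0 ≤ 2 * (Lj * δ₀ * N') := by positivity
  -- (J): the Hermite constant is `0` for `m = 0` (then the J-term vanishes) and `e^{log Hm}` otherwise
  have hJb : Real.exp (γb * N') *
      (2 * ((2 * m : ℕ) : ℝ) ^ (t + 1) * t * (20 * Real.exp 1) ^ ((2 * m) * t) *
        (2 ^ t * ((2 * C) ^ t * Real.exp (γb * (2 * m)) *
          ((2 : ℝ) ^ a * Real.exp (SΓ / C) *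
            (Uc * (P * DΔ) * Wn * Real.exp ((γb + w) * ((2 * m - 1 : ℕ) : ℝ)) * (2 * (Lj * δ₀ * ((2 * m - 1 : ℕ) : ℝ)))))))) ≤
      1 / (Dn : ℝ) / 3 := by
    have h1 := mul_le_exp_add coreO hb hboxO0
    have h2 : (2 : ℝ) ^ a * Real.exp (SΓ / C) *
        ((Uc : ℝ) * (P * DΔ) * Wn * Real.exp ((γb + w) * ((2 * m - 1 : ℕ) : ℝ)) * (2 * (Lj * δ₀ * ((2 * m - 1 : ℕ) : ℝ)))) ≤
        Real.exp (a * Real.log 2 + SΓ / C +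
          (cU + (cP + Real.log DΔ) + Real.log Wn + (γb + w) * ((2 * m - 1 : ℕ) : ℝ) + cb)) :=
      mul_le_exp_add (by rw [e2a, ← Real.exp_add]) h1 (by positivity)
    have h3 := mul_le_exp_add (show (2 * C) ^ t * Real.exp (γb * (2 * m)) ≤ Real.exp (t * Real.log (2 * C) + γb * (2 * m)) by
      rw [eCt, ← Real.exp_add]) h2 (by positivity)
    have h4 := mul_le_exp_add (show (2 : ℝ) ^ t ≤ Real.exp (t * Real.log 2) by rw [e2t]) h3 (by positivity)
    rcases Nat.eq_zero_or_pos m with hm0 | hm0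
    · -- `m = 0`: the Hermite constant vanishes
      subst hm0
      have hD0 : (0 : ℝ) ≤ 1 / (Dn : ℝ) / 3 := by positivity
      have : 2 * ((2 * 0 : ℕ) : ℝ) ^ (t + 1) * t * (20 * Real.exp 1) ^ ((2 * 0) * t) = 0 := by simp
      rw [this]
      simpa using hD0
    · have hHm' : 0 < 2 * ((2 * m : ℕ) : ℝ) ^ (t + 1) * t * (20 * Real.exp 1) ^ ((2 * m) * t) := by positivity
      have h5 := mul_le_exp_add (le_exp_log_of_pos hHm') h4 (by positivity)
      have h6 := mul_le_exp_add (le_refl (Real.exp (γb * N'))) h5 (by positivity)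
      refine le_third_of_log_line hDn h6 ?_
      linarith
  -- (F)
  have hFb : Real.exp (γb * N') *
      ((Uc : ℝ) * (P * DΔ) * Wd * Real.exp ((w + Lj * δ₀) * ((12 * E + 6) * m)) * (1 / E) ^ ((2 * m) * t)) ≤ 1 / (Dn : ℝ) / 3 := by
    have h1 : (Uc : ℝ) * (P * DΔ) * Wd * Real.exp ((w + Lj * δ₀) * ((12 * E + 6) * m)) * (1 / E) ^ ((2 * m) * t) ≤
        Real.exp (cU + (cP + Real.log DΔ) + Real.log Wd + (w + Lj * δ₀) * ((12 * E + 6) * m) +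
          -(((2 * m) * t : ℕ) * Real.log E)) := mul_le_exp_add coreD (by rw [eE]) (by positivity)
    have h2 := mul_le_exp_add (le_refl (Real.exp (γb * N'))) h1 (by positivity)
    refine le_third_of_log_line hDn h2 ?_
    linarith
  -- (C)
  have hCb : (Uc : ℝ) * (P * DΔ) * Wn * Real.exp ((γb + w) * N') * (2 * (Lj * δ₀ * N')) < 1 / (Dn : ℝ) / 3 := by
    have h1 := mul_le_exp_add coreN' hb' hboxN'0
    refine lt_third_of_log_line hDn h1 ?_
    linarith
  have hsplit : Real.exp (γb * N') *
      (2 * ((2 * m : ℕ) : ℝ) ^ (t + 1) * t * (20 * Real.exp 1) ^ ((2 * m) * t) *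
          (2 ^ t * ((2 * C) ^ t * Real.exp (γb * (2 * m)) *
            ((2 : ℝ) ^ a * Real.exp (SΓ / C) *
              (Uc * (P * DΔ) * Wn * Real.exp ((γb + w) * ((2 * m - 1 : ℕ) : ℝ)) * (2 * (Lj * δ₀ * ((2 * m - 1 : ℕ) : ℝ))))))) +
        Uc * (P * DΔ) * Wd * Real.exp ((w + Lj * δ₀) * ((12 * E + 6) * m)) * (1 / E) ^ ((2 * m) * t)) =
      Real.exp (γb * N') *
        (2 * ((2 * m : ℕ) : ℝ) ^ (t + 1) * t * (20 * Real.exp 1) ^ ((2 * m) * t) *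
          (2 ^ t * ((2 * C) ^ t * Real.exp (γb * (2 * m)) *
            ((2 : ℝ) ^ a * Real.exp (SΓ / C) *
              (Uc * (P * DΔ) * Wn * Real.exp ((γb + w) * ((2 * m - 1 : ℕ) : ℝ)) * (2 * (Lj * δ₀ * ((2 * m - 1 : ℕ) : ℝ)))))))) +
      Real.exp (γb * N') *
        (Uc * (P * DΔ) * Wd * Real.exp ((w + Lj * δ₀) * ((12 * E + 6) * m)) * (1 / E) ^ ((2 * m) * t)) := by
    ring
  rw [hsplit]
  linarith

/-- **`ArchKStepOddHypD` at `S(θ)` from three log lines per `(x₁, a)`** (first k-step of a level; V := virtual box, `Dm := Dmv Bv`).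
[cite: Nesterenko2003, §4.2 with the nodes 𝒳_{s,0}; shape only] -/
theorem archKStepOddHypD_of_logLinesV (F : S.SatData) {H : ℕ} (hH : 1 ≤ H) (ex L₀ : ℕ) (U : Finset (ℕ × K))
    (hU : ∀ i ∈ U, i.1 ≤ L₀) (L : Fin S.n → ℕ) {P : ℤ} (hP0 : 0 ≤ P) {w : ℝ} (hw : 0 ≤ w) (γb : ℝ) (c : ℤ) (e : Fin S.n → ℤ)
    {δ₀ : ℝ} (hδ : 0 ≤ δ₀) (Bv : Fin S.n → ℕ) {m N' T T' t : ℕ} (hm : 1 ≤ m) (ht : 1 ≤ t) (hT : T' + t ≤ T) (hN' : N' ≤ 6 * m)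
    {A : Fin S.n → ℝ} (hA : ∀ k, |S.lg k| ≤ A k) {E : ℝ} (hE : 1 ≤ E) (hsmall : (L S.j₀ : ℝ) * δ₀ * (6 * m) ≤ 1) {C : ℝ} (hC : 1 ≤ C)
    {V : Fin S.n → ℝ} (hV : ∀ j, Height.logHeight₁ (F.αo j) ≤ V j)
    {cU cP cb cb' : ℝ} (hcU : (U.card : ℝ) ≤ Real.exp cU) (hcP : (P : ℝ) ≤ Real.exp cP)
    (hcb : 2 * ((L S.j₀ : ℝ) * δ₀ * ((2 * m - 1 : ℕ) : ℝ)) ≤ Real.exp cb) (hcb' : 2 * ((L S.j₀ : ℝ) * δ₀ * N') ≤ Real.exp cb')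
    (hJ : ∀ (x₁ : ℤ) (a : ℕ), |x₁| ≤ (N' : ℤ) → a < T' →
      γb * N' + Real.log (2 * ((2 * m : ℕ) : ℝ) ^ (t + 1) * t * (20 * Real.exp 1) ^ ((2 * m) * t)) + t * Real.log 2 +
        t * Real.log (2 * C) + γb * (2 * m) + a * Real.log 2 + (∑ k, A k * S.GammaC L k) / C + cU + cP +
        Real.log (DΔC (S.YC c e L) T') + Real.log (WC H ex L₀ T (6 * m)) + (γb + w) * ((2 * m - 1 : ℕ) : ℝ) + cb +
        (23 / 20 * a * H + 2 * |(x₁ : ℝ)| * (∑ j, ((Bv j : ℝ) / F.N) * V j) + 2 * ∑ j, V j) + Real.log 3 ≤ 0)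
    (hFl : ∀ (x₁ : ℤ) (a : ℕ), |x₁| ≤ (N' : ℤ) → a < T' →
      γb * N' + cU + cP + Real.log (DΔC (S.YC c e L) T') + Real.log (WC H ex L₀ T' ((12 * E + 6) * m)) +
        (w + (L S.j₀ : ℝ) * δ₀) * ((12 * E + 6) * m) - ((2 * m) * t : ℕ) * Real.log E +
        (23 / 20 * a * H + 2 * |(x₁ : ℝ)| * (∑ j, ((Bv j : ℝ) / F.N) * V j) + 2 * ∑ j, V j) + Real.log 3 ≤ 0)
    (hCl : ∀ (x₁ : ℤ) (a : ℕ), |x₁| ≤ (N' : ℤ) → a < T' →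
      cU + cP + Real.log (DΔC (S.YC c e L) T') + Real.log (WC H ex L₀ T (6 * m)) + (γb + w) * N' + cb' +
        (23 / 20 * a * H + 2 * |(x₁ : ℝ)| * (∑ j, ((Bv j : ℝ) / F.N) * V j) + 2 * ∑ j, V j) + Real.log 3 < 0) :
    S.ArchKStepOddHypD (fun i : ℕ × K => scaledFeldR i.1 H ex) U L P w γb c e δ₀ (fun w' => ∀ j, |(w' ᵥ* F.U) j| ≤ (Bv j : ℤ))
      m N' T T' := by
  have hH' : (0 : ℝ) < H := by exact_mod_cast hH
  have hDΔ : 0 < DΔC (S.YC c e L) T' := by unfold DΔC; have := S.YC_nonneg c e L; positivity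
  have hWn : 0 < WC H ex L₀ T (6 * m) := by unfold WC; positivity
  have hE0 : (0 : ℝ) ≤ E := le_trans zero_le_one hE
  have hWd : 0 < WC H ex L₀ T' ((12 * E + 6) * m) := by unfold WC; positivity
  refine S.archKStepOddHypD_of_ineqV F hH ex L₀ U hU L P hw γb c e Bv hm ht hT hN' hA hE hsmall hC fun x₁ hx₁ a μ haμ => ?_
  have ha : a < T' := by omega
  have hDn : 1 ≤ (Nat.lcmUpto H) ^ a * F.Dmv Bv x₁ := one_le_mul (Nat.one_le_pow _ _ (Nat.lcmUpto_pos H)) (F.one_le_Dmv Bv x₁)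
  have hD : Real.log ((((Nat.lcmUpto H) ^ a * F.Dmv Bv x₁ : ℕ)) : ℝ) ≤
      23 / 20 * a * H + 2 * |(x₁ : ℝ)| * (∑ j, ((Bv j : ℝ) / F.N) * V j) + 2 * ∑ j, V j := by
    have h1 : (0 : ℝ) < (((Nat.lcmUpto H) ^ a : ℕ) : ℝ) := by exact_mod_cast pow_pos (Nat.lcmUpto_pos H) a
    have h2 : (0 : ℝ) < (F.Dmv Bv x₁ : ℝ) := by exact_mod_cast F.one_le_Dmv Bv x₁
    rw [Nat.cast_mul, Real.log_mul h1.ne' h2.ne']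
    linarith [ArchSupply.log_lcm_pow_le H a, F.log_Dmv_le_of_weights Bv x₁ hV]
  exact kstep_odd_ineq_of_logLines ht hC hE hDΔ hWn hWd (by exact_mod_cast hP0) hδ (Nat.cast_nonneg _) hcU hcP hcb hcb' hDn hD
    (hJ x₁ a hx₁ ha) (hFl x₁ a hx₁ ha) (hCl x₁ a hx₁ ha)

end ArchG3Setup

end Summit.ABC.StewartYu

end
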